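import Mathlib
import Literature.Analysis.FluidPDE.VectorCalculus
import Literature.Analysis.FluidPDE.TaoAveragedNondegeneracy
import Summits.NavierStokesRegularity.NavierStokesRegularity.Theorems.FilamentSkeletonRssSkeletonEquilibriumGyrationFreeArcs
import Summits.NavierStokesRegularity.NavierStokesRegularity.Theorems.FilamentSkeletonRssSkeletonEquilibriumMirrorPointLimit
import Summits.NavierStokesRegularity.NavierStokesRegularity.Theorems.FilamentSkeletonRssSkeletonEquilibriumForcedShooting

/-!
# `stub_mirrorPointSelection` (registered stub of crux `FilamentSkeletonRss.SkeletonEquilibrium`, stmt-NavierStokesRegularity-15400,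
lines `mirror-point-negation` / `zero-accretion-selection`) — proved by rigidity + continuous dependence + compactness

* `mirrorPoint_fixed` — for FIXED `g ≠ 0`, `α ≠ 0`, `θ > 0` there are `ε₀ > 0`, `0 < R₁ ≤ R₃` such that every `C²`
  unit-speed solution of `Yo″ = g • Yo′ × A Yo` (`A y = ½ y − α e₃ × y`) whose first-order gyration defect obeys
  `‖defect‖ ‖Yo‖ ≤ ε₀` on the shell `R₁ ≤ ‖Yo‖ ≤ R₃` is `θ`-vertical in the ball `‖Yo‖ ≤ 2`.
  Proof by contradiction: bad solutions for `ε₀ = R₁ = 1/(m+1)`, `R₃ = m+1`, recentred at the bad point (the ODE is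
  autonomous); a subsequence of the data `(Yo(0), Yo′(0)) ∈ B̄(0,2) × S²` converges; the solution through the limit datum
  (`Sketch.stub_forcedShooting`) is the pointwise limit and lies on the polynomial gyration-free locus wherever it is
  nonzero (`MirrorPoint.locus_of_limit`), in particular on an interval `(0, δ)` (`MirrorPoint.exists_Ioo_ne_zero`); by
  the rigidity of exactly gyration-free arcs (`MirrorPoint.arc_on_axis_of_locus`) its tangent is vertical there, hence at
  `0` — contradicting `‖e* × e₃‖ ≥ θ`.
* `stub_mirrorPointSelection` — the REGISTERED statement verbatim: finitely many filaments `k : Fin N` with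
  `g = 4π/γ_k`; take the min/max of the per-`k` constants (the shell hypothesis is monotone in `(ε₀, R₁, R₃)`).
No numerics are used. No summit statement is proved; NS regularity is not touched.
-/

noncomputable section

open Set Filter Topology
open Literature.Analysis.FluidPDE Literature.Analysis.FluidPDE.Tao2016
open scoped RealInnerProductSpace InnerProductSpace

namespace Summit.NavierStokesRegularity.NavierStokesRegularity.Theorems.SkeletonEquilibrium.MirrorPoint
set_option linter.dupNamespace false

/-- **`stub_mirrorPointSelection` for one filament and fixed parameters.** [folklore] -/
theorem mirrorPoint_fixed {g α θ : ℝ} (hg : g ≠ 0) (hα : α ≠ 0) (hθ : 0 < θ) :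
    ∃ ε₀ R₁ R₃ : ℝ, 0 < ε₀ ∧ 0 < R₁ ∧ R₁ ≤ R₃ ∧
      ∀ (Yo : ℝ → EuclideanSpace ℝ (Fin 3)), ContDiff ℝ 2 Yo → (∀ s, ‖deriv Yo s‖ = 1) →
        (∀ s, iteratedDeriv 2 Yo s = g • cross (deriv Yo s)
          ((1 / 2 : ℝ) • Yo s - α • cross (EuclideanSpace.single (2 : Fin 3) (1 : ℝ)) (Yo s))) →
        (∀ (s : ℝ), R₁ ≤ ‖Yo s‖ → ‖Yo s‖ ≤ R₃ → ∀ (B b Bt : EuclideanSpace ℝ (Fin 3)) (c : ℝ),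
          B = (1 / 2 : ℝ) • Yo s - α • cross (EuclideanSpace.single (2 : Fin 3) (1 : ℝ)) (Yo s) →
          b = ‖B‖⁻¹ • B →
          Bt = (1 / 2 : ℝ) • deriv Yo s - α • cross (EuclideanSpace.single (2 : Fin 3) (1 : ℝ)) (deriv Yo s) →
          c = ⟪deriv Yo s, b⟫ →
          ‖deriv Yo s - c • b - (c / g / ‖B‖ ^ 2) • cross b Bt‖ * ‖Yo s‖ ≤ ε₀) →
        ∀ s, ‖Yo s‖ ≤ 2 → ‖cross (deriv Yo s) (EuclideanSpace.single (2 : Fin 3) (1 : ℝ))‖ ≤ θ := by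
  by_contra H
  push Not at H
  have hle : ∀ m : ℕ, (1 : ℝ) / ((m : ℝ) + 1) ≤ (m : ℝ) + 1 := fun m => by
    have h1 : (1 : ℝ) / ((m : ℝ) + 1) ≤ 1 := (div_le_one (by positivity)).2 (by linarith [m.cast_nonneg (α := ℝ)])
    linarith [m.cast_nonneg (α := ℝ)]
  have H' := fun m : ℕ => H (1 / ((m : ℝ) + 1)) (1 / ((m : ℝ) + 1)) ((m : ℝ) + 1)
    (by positivity) (by positivity) (hle m)
  choose Y hYC hYu hYo hYsh s hs2 hsθ using H'
  -- recentre at the bad points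
  set Z : ℕ → ℝ → EuclideanSpace ℝ (Fin 3) := fun m t => Y m (t + s m) with hZdef
  have hZC : ∀ m, ContDiff ℝ 2 (Z m) := fun m => (hYC m).comp (contDiff_id.add contDiff_const)
  have hZd : ∀ m t, deriv (Z m) t = deriv (Y m) (t + s m) := fun m t => deriv_comp_add_const (Y m) (s m) t
  have hZ2 : ∀ m t, iteratedDeriv 2 (Z m) t = iteratedDeriv 2 (Y m) (t + s m) := fun m t => by
    have := iteratedDeriv_comp_add_const 2 (Y m) (s m)
    exact congrFun this t
  have hZu : ∀ m t, ‖deriv (Z m) t‖ = 1 := fun m t => by rw [hZd]; exact hYu m _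
  have hZo : ∀ m t, iteratedDeriv 2 (Z m) t = g • cross (deriv (Z m) t)
      ((1 / 2 : ℝ) • Z m t - α • cross (EuclideanSpace.single (2 : Fin 3) (1 : ℝ)) (Z m t)) := fun m t => by
    rw [hZ2, hZd]; exact hYo m _
  have hZ0 : ∀ m, ‖Z m 0‖ ≤ 2 := fun m => by
    show ‖Y m (0 + s m)‖ ≤ 2; rw [zero_add]; exact hs2 m
  have hZθ : ∀ m, θ < ‖cross (deriv (Z m) 0) (EuclideanSpace.single (2 : Fin 3) (1 : ℝ))‖ := fun m => by
    rw [hZd, zero_add]; exact hsθ m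
  have hZsh : ∀ (m : ℕ) (t : ℝ), 1 / ((m : ℝ) + 1) ≤ ‖Z m t‖ → ‖Z m t‖ ≤ (m : ℝ) + 1 →
      ‖deriv (Z m) t -
          ⟪deriv (Z m) t, ‖(1 / 2 : ℝ) • Z m t - α • cross (EuclideanSpace.single (2 : Fin 3) (1 : ℝ)) (Z m t)‖⁻¹ •
            ((1 / 2 : ℝ) • Z m t - α • cross (EuclideanSpace.single (2 : Fin 3) (1 : ℝ)) (Z m t))⟫ •
          (‖(1 / 2 : ℝ) • Z m t - α • cross (EuclideanSpace.single (2 : Fin 3) (1 : ℝ)) (Z m t)‖⁻¹ •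
            ((1 / 2 : ℝ) • Z m t - α • cross (EuclideanSpace.single (2 : Fin 3) (1 : ℝ)) (Z m t))) -
        (⟪deriv (Z m) t, ‖(1 / 2 : ℝ) • Z m t - α • cross (EuclideanSpace.single (2 : Fin 3) (1 : ℝ)) (Z m t)‖⁻¹ •
            ((1 / 2 : ℝ) • Z m t - α • cross (EuclideanSpace.single (2 : Fin 3) (1 : ℝ)) (Z m t))⟫ / g /
            ‖(1 / 2 : ℝ) • Z m t - α • cross (EuclideanSpace.single (2 : Fin 3) (1 : ℝ)) (Z m t)‖ ^ 2) •
          cross (‖(1 / 2 : ℝ) • Z m t - α • cross (EuclideanSpace.single (2 : Fin 3) (1 : ℝ)) (Z m t)‖⁻¹ •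
              ((1 / 2 : ℝ) • Z m t - α • cross (EuclideanSpace.single (2 : Fin 3) (1 : ℝ)) (Z m t)))
            ((1 / 2 : ℝ) • deriv (Z m) t - α • cross (EuclideanSpace.single (2 : Fin 3) (1 : ℝ)) (deriv (Z m) t))‖ *
        ‖Z m t‖ ≤ 1 / ((m : ℝ) + 1) := by
    intro m t h1 h2
    rw [hZd]
    exact hYsh m (t + s m) h1 h2 _ _ _ _ rfl rfl rfl rfl
  -- compactness of the data
  have hK : IsCompact (Metric.closedBall (0 : EuclideanSpace ℝ (Fin 3)) 2 ×ˢ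
      Metric.closedBall (0 : EuclideanSpace ℝ (Fin 3)) 1) :=
    (isCompact_closedBall _ _).prod (isCompact_closedBall _ _)
  obtain ⟨d, hdK, φ, hφ, hlim⟩ := hK.tendsto_subseq (x := fun m => (Z m 0, deriv (Z m) 0))
    (fun m => ⟨mem_closedBall_zero_iff.2 (hZ0 m), mem_closedBall_zero_iff.2 (hZu m 0).le⟩)
  have hd1 : Tendsto (fun m => Z (φ m) 0) atTop (𝓝 d.1) := (continuous_fst.tendsto _).comp hlim
  have hd2 : Tendsto (fun m => deriv (Z (φ m)) 0) atTop (𝓝 d.2) := (continuous_snd.tendsto _).comp hlim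
  have he : ‖d.2‖ = 1 := by
    have h1 : Tendsto (fun m => ‖deriv (Z (φ m)) 0‖) atTop (𝓝 ‖d.2‖) := (continuous_norm.tendsto _).comp hd2
    have h2 : Tendsto (fun m => ‖deriv (Z (φ m)) 0‖) atTop (𝓝 1) := by
      simp only [hZu]; exact tendsto_const_nhds
    exact tendsto_nhds_unique h1 h2
  have hd1n : ‖d.1‖ ≤ 2 := mem_closedBall_zero_iff.1 hdK.1
  -- the solution through the limit datum
  obtain ⟨Ys, hYsC, hYs0, hYs'0, hYsu, hYso'⟩ :=
    (Sketch.stub_forcedShooting g α (fun _ => 0) d.1 d.2 continuous_const he).1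
  have hYso : ∀ t, iteratedDeriv 2 Ys t = g • cross (deriv Ys t)
      ((1 / 2 : ℝ) • Ys t - α • cross (EuclideanSpace.single (2 : Fin 3) (1 : ℝ)) (Ys t)) := fun t => by
    have := hYso' t; simpa only [add_zero] using this
  -- parameters of the subsequence
  have hφt : Tendsto φ atTop atTop := hφ.tendsto_atTop
  have hε : Tendsto (fun m => (1 : ℝ) / ((φ m : ℝ) + 1)) atTop (𝓝 0) :=
    (tendsto_one_div_add_atTop_nhds_zero_nat (𝕜 := ℝ)).comp hφt
  have hR₃ : Tendsto (fun m => (φ m : ℝ) + 1) atTop atTop :=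
    tendsto_atTop_add_const_right _ _ (tendsto_natCast_atTop_atTop.comp hφt)
  -- the limit is on the locus wherever nonzero (t ≥ 0)
  have hloc : ∀ t, 0 ≤ t → Ys t ≠ 0 → _ := fun t ht hYt =>
    locus_of_limit (α := α) hg (Z := fun m => Z (φ m)) (ε := fun m => 1 / ((φ m : ℝ) + 1))
      (R₁ := fun m => 1 / ((φ m : ℝ) + 1)) (R₃ := fun m => (φ m : ℝ) + 1)
      (fun m => hZC (φ m)) (fun m => hZu (φ m)) (fun m => hZo (φ m)) (fun m => hZ0 (φ m))
      (fun m => hZsh (φ m)) hε hε hR₃ hYsC hYsu hYso (by rw [hYs0]; exact hd1n)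
      (by rw [hYs0]; exact hd1) (by rw [hYs'0]; exact hd2) ht hYt
  -- an interval (0, δ) where the limit is nonzero; there it is vertical
  obtain ⟨δ, hδ, hne⟩ := exists_Ioo_ne_zero hYsC hYsu
  have hvert := arc_on_axis_of_locus hg hα hYsC hYsu hYso isOpen_Ioo
    (fun σ hσ => hloc σ hσ.1.le (hne σ hσ))
  -- vertical at 0 by right-continuity of Ys′
  have hcont : Continuous (fun t => cross (deriv Ys t) (EuclideanSpace.single (2 : Fin 3) (1 : ℝ))) :=
    continuous_cross.comp ((hYsC.continuous_deriv (by norm_num)).prodMk continuous_const)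
  have h0 : cross (deriv Ys 0) (EuclideanSpace.single (2 : Fin 3) (1 : ℝ)) = 0 := by
    have h1 : Tendsto (fun t => cross (deriv Ys t) (EuclideanSpace.single (2 : Fin 3) (1 : ℝ)))
        (𝓝[>] 0) (𝓝 (cross (deriv Ys 0) (EuclideanSpace.single (2 : Fin 3) (1 : ℝ)))) :=
      (hcont.tendsto 0).mono_left nhdsWithin_le_nhds
    have h2 : Tendsto (fun t => cross (deriv Ys t) (EuclideanSpace.single (2 : Fin 3) (1 : ℝ)))
        (𝓝[>] 0) (𝓝 0) := by
      apply tendsto_const_nhds.congr'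
      filter_upwards [Ioo_mem_nhdsGT hδ] with t ht
      exact ((hvert t ht).2.2).symm
    exact tendsto_nhds_unique h1 h2
  -- contradiction with the bad tangents
  have hlimcross : Tendsto (fun m => ‖cross (deriv (Z (φ m)) 0) (EuclideanSpace.single (2 : Fin 3) (1 : ℝ))‖)
      atTop (𝓝 ‖cross d.2 (EuclideanSpace.single (2 : Fin 3) (1 : ℝ))‖) :=
    ((continuous_norm.comp (continuous_cross.comp (continuous_id.prodMk continuous_const))).tendsto d.2).comp
      hd2
  have hzero : ‖cross d.2 (EuclideanSpace.single (2 : Fin 3) (1 : ℝ))‖ = 0 := by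
    rw [← hYs'0, h0, norm_zero]
  rw [hzero] at hlimcross
  obtain ⟨m, hm⟩ := (hlimcross.eventually (gt_mem_nhds hθ)).exists
  exact absurd (hZθ (φ m)) (not_lt.2 hm.le)

/-- **Registered stub `stub_mirrorPointSelection`** (crux `FilamentSkeletonRss.SkeletonEquilibrium`, negation lines
`mirror-point-negation` / `zero-accretion-selection`): proved from `mirrorPoint_fixed` filament by filament, taking the
minimum / maximum of the finitely many constants. [folklore] -/
theorem stub_mirrorPointSelection : ∀ (N : ℕ) (γ : Fin N → ℝ) (α : ℝ), α ≠ 0 → (∀ k, γ k ≠ 0) → ∀ θ : ℝ, 0 < θ → ∃ ε₀ R₁ R₃ : ℝ, 0 < ε₀ ∧ 0 < R₁ ∧ R₁ ≤ R₃ ∧ ∀ (k : Fin N) (Yo : ℝ → EuclideanSpace ℝ (Fin 3)), ContDiff ℝ 2 Yo → (∀ s, ‖deriv Yo s‖ = 1) → (∀ s, iteratedDeriv 2 Yo s = (4 * Real.pi / γ k) • cross (deriv Yo s) ((1 / 2 : ℝ) • Yo s - α • cross (EuclideanSpace.single (2 : Fin 3) (1 : ℝ)) (Yo s))) → (∀ (s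 : ℝ), R₁ ≤ ‖Yo s‖ → ‖Yo s‖ ≤ R₃ → ∀ (B b Bt : EuclideanSpace ℝ (Fin 3)) (c : ℝ), B = (1 / 2 : ℝ) • Yo s - α • cross (EuclideanSpace.single (2 : Fin 3) (1 : ℝ)) (Yo s) → b = ‖B‖⁻¹ • B → Bt = (1 / 2 : ℝ) • deriv Yo s - α • cross (EuclideanSpace.single (2 : Fin 3) (1 : ℝ)) (deriv Yo s) → c = ⟪deriv Yo s, b⟫ → ‖deriv Yo s - c • b - (c / (4 * Real.pi / γ k) / ‖B‖ ^ 2) • cross b Bt‖ * ‖Yo s‖ ≤ ε₀) → ∀ s, ‖Yo s‖ ≤ 2 → ‖cross (deriv Yo s) (EuclideanSpace.single (2 : Fin 3) (1 : ℝ))‖ ≤ θ := by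
  intro N γ α hα hγ θ hθ
  have hk : ∀ k : Fin N, ∃ ε₀ R₁ R₃ : ℝ, 0 < ε₀ ∧ 0 < R₁ ∧ R₁ ≤ R₃ ∧
      ∀ (Yo : ℝ → EuclideanSpace ℝ (Fin 3)), ContDiff ℝ 2 Yo → (∀ s, ‖deriv Yo s‖ = 1) →
        (∀ s, iteratedDeriv 2 Yo s = (4 * Real.pi / γ k) • cross (deriv Yo s)
          ((1 / 2 : ℝ) • Yo s - α • cross (EuclideanSpace.single (2 : Fin 3) (1 : ℝ)) (Yo s))) →
        (∀ (s : ℝ), R₁ ≤ ‖Yo s‖ → ‖Yo s‖ ≤ R₃ → ∀ (B b Bt : EuclideanSpace ℝ (Fin 3)) (c : ℝ),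
          B = (1 / 2 : ℝ) • Yo s - α • cross (EuclideanSpace.single (2 : Fin 3) (1 : ℝ)) (Yo s) →
          b = ‖B‖⁻¹ • B →
          Bt = (1 / 2 : ℝ) • deriv Yo s - α • cross (EuclideanSpace.single (2 : Fin 3) (1 : ℝ)) (deriv Yo s) →
          c = ⟪deriv Yo s, b⟫ →
          ‖deriv Yo s - c • b - (c / (4 * Real.pi / γ k) / ‖B‖ ^ 2) • cross b Bt‖ * ‖Yo s‖ ≤ ε₀) →
        ∀ s, ‖Yo s‖ ≤ 2 → ‖cross (deriv Yo s) (EuclideanSpace.single (2 : Fin 3) (1 : ℝ))‖ ≤ θ :=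
    fun k => mirrorPoint_fixed (div_ne_zero (by positivity) (hγ k)) hα hθ
  choose ε R₁ R₃ hε hR₁ hR₁₃ hP using hk
  by_cases hN : N = 0
  · subst hN
    exact ⟨1, 1, 1, one_pos, one_pos, le_rfl, fun k => Fin.elim0 k⟩
  · have hne : (Finset.univ : Finset (Fin N)).Nonempty :=
      ⟨⟨0, Nat.pos_of_ne_zero hN⟩, Finset.mem_univ _⟩
    refine ⟨Finset.univ.inf' hne ε, Finset.univ.inf' hne R₁, Finset.univ.sup' hne R₃,
      (Finset.lt_inf'_iff hne).2 (fun k _ => hε k), (Finset.lt_inf'_iff hne).2 (fun k _ => hR₁ k), ?_, ?_⟩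
    · obtain ⟨k₀, hk₀⟩ := hne
      exact (Finset.inf'_le _ hk₀).trans ((hR₁₃ k₀).trans (Finset.le_sup' _ hk₀))
    · intro k Yo hC hunit hode hshell s hs
      refine hP k Yo hC hunit hode ?_ s hs
      intro s' h1 h2 B b Bt c hB hb hBt hc
      have := hshell s' ((Finset.inf'_le _ (Finset.mem_univ k)).trans h1)
        (h2.trans (Finset.le_sup' _ (Finset.mem_univ k))) B b Bt c hB hb hBt hc
      exact this.trans (Finset.inf'_le _ (Finset.mem_univ k))

end Summit.NavierStokesRegularity.NavierStokesRegularity.Theorems.SkeletonEquilibrium.MirrorPoint
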